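import Literature.NumberTheory.Sieve.PolynomialOmegaNoAtom

/-!
# Crux `QuadraticOmegaParity` (stmt-Parity-11585), line `ShapeToParityProof` (card
# `shape-kills-parity`): the stub `EKNoAtom` — no atom for `ω(f(n))` along an irreducible quadratic

Along every irreducible integer quadratic `f` with positive leading coefficient and every
progression `a mod q`, for every `ε > 0`, once `x` is large no single value `j` of `ω(f(n))` is taken
by more than `εx` of the `n ≤ x` (the anti-concentration half of an Erdős–Kac law for `ω(f(n))`,
Halberstam 1956). This is exactly the tree's PROVED
`Literature.NumberTheory.Sieve.PolynomialOmegaNoAtom.quadratic_omega_no_atom` (Kubilius model at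
level `x^{1/v}` + the uniform Fundamental Lemma of the sieve + a Fourier bound for the model, all
proved in `Literature/NumberTheory/Sieve/PolynomialOmegaNoAtom.lean`); this file only records it
under the registered stub name `Summit.Parity.BatemanHorn.Theorems.stub_EKNoAtom`.
-/

namespace Summit.Parity.BatemanHorn.Theorems

/-- **No atom for `ω(f(n))`** (stub `stub_EKNoAtom` of the line `ShapeToParityProof`): for every
irreducible `f ∈ ℤ[X]` of degree `2` with positive leading coefficient, every `q ≥ 1`, `a`, and
every `ε > 0`, eventually in `x`, for all `j`,
`#{1 ≤ n ≤ x : n ≡ a (mod q), ω(f(n)) = j} ≤ ε x`. The tree's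
`Literature.NumberTheory.Sieve.PolynomialOmegaNoAtom.quadratic_omega_no_atom`. -/
theorem stub_EKNoAtom :
    ∀ f : Polynomial ℤ, Irreducible f → f.natDegree = 2 → 0 < f.leadingCoeff → ∀ q a : ℕ, 0 < q →
      ∀ ε : ℝ, 0 < ε → ∀ᶠ x : ℕ in Filter.atTop, ∀ j : ℕ,
        ((((Finset.Icc 1 x).filter (fun n : ℕ => n ≡ a [MOD q] ∧
            ArithmeticFunction.cardDistinctFactors ((f.eval (n : ℤ)).toNat) = j)).card : ℕ) : ℝ)
          ≤ ε * x :=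
  Literature.NumberTheory.Sieve.PolynomialOmegaNoAtom.quadratic_omega_no_atom

end Summit.Parity.BatemanHorn.Theorems
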